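import Literature.AlgebraicGeometry.Motives.RigidTuplesKatzAlgorithm
import Literature.AlgebraicGeometry.Motives.LinearlyRigidIndexTwo
import HarnessLib

/-!
# `MC_1(V) ≅ V`, the inversion `MC_{λ⁻¹}(MC_λ(V)) ≅ V`, and Katz's existence algorithm discharged

Topic `Literature/AlgebraicGeometry/Motives`; companions of
`Literature.AlgebraicGeometry.Motives.middleConvolution` (`MiddleConvolution.lean`: the
Dettweiler–Reiter tuple model `MC_λ` of Katz's middle convolution `MC_χ`, in the block-row
convention of [DettweilerReiter2007, Def. 2.1]).  Everything here is PROVED.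

* `MiddleConvolution.exists_equiv_one` — [DettweilerReiter2000, Prop. 3.2]: "Let `λ = 1` and
  `U_{r+1} = V`.  Then the modules `MC_1(V)` and `V` are isomorphic" (`U_{r+1} := Σ_i im(A_i - 1)`,
  loc. cit. §3); restated in [Haraoka2020, §7.5.1, p. 195] as "`MC_1(V) ≃ V`".  We follow the printed
  proof: for `λ = 1` every defect `D_k(w) = ((B_k - 1)w)_k` equals `φ(w) := Σ_i (A_i - 1) w_i`
  (tree: `MiddleConvolution.defect_one`, [DettweilerReiter2000, Lemma 2.7 (a)]), hence
  `𝒦 ⊆ ℒ = ker φ` and `MC_1(V) = V^r / ker φ`; `φ` is onto because `U_{r+1} = V`; and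
  `φ ∘ B_k = A_k ∘ φ` ("readily checked": `B_k w = w + e_k ⊗ φ(w)`).
* `MiddleConvolution.middleConvolution_inv_equiv` — **inversion** `MC_{λ⁻¹}(MC_λ(V)) ≅ V` for a
  module `V` over `F_r`, `r ≥ 1`, satisfying Dettweiler–Reiter's conditions `(*)` and `(**)`
  ([DettweilerReiter2007, Def. 2.3] = tree `CondStar`, `CondStarStar`) and every `λ ∈ Kˣ`: the tree's
  multiplicativity `DettweilerReiter2007_mul_holds` (`MC_{λ₂}(MC_{λ₁}(V)) ≅ MC_{λ₁λ₂}(V)`,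
  [DettweilerReiter2007, Thm. 2.4 (ii)] = [DettweilerReiter2000, Thm. 3.5]) composed with
  `exists_equiv_one` (`(**)` at `τ = 1` gives `U_{r+1} = V`).  This is the step "applying the convolution `MC_{λ⁻¹}` to
  `MC_λ(V)` we get `W := MC_{λ⁻¹}(M) ≤ V`" of [DettweilerReiter2000, proof of Cor. 3.6], the tuple
  form of Katz's `MC_χ̄ ∘ MC_χ ≅ id` ([Katz1996, Ch. 5]; [Haraoka2020, §7.5.1, p. 195]:
  "`MC_1(V) ≃ V`, `MC_λ(MC_μ(V)) ≃ MC_{λμ}(V)`").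
* `DettweilerReiter2000_thm_4_9_holds` — the named fact `DettweilerReiter2000_thm_4_9` of
  `RigidTuples.lean` (Katz's existence algorithm: an irreducible linearly rigid tuple with `T_∞ = 1`
  over an algebraically closed field is connected to rank one by multiplications and middle
  convolutions; [DettweilerReiter2000, Thm. 4.9], [Haraoka2020, Thm. 7.24]) HOLDS: the tree proves
  `DettweilerReiter2000_thm_4_9_of_lemma_4_7` (`RigidTuplesKatzAlgorithm.lean`) and
  `DettweilerReiter2000_lemma_4_7_holds` (`LinearlyRigidIndexTwo.lean`); we compose them.

## References
* M. Dettweiler, S. Reiter, *An algorithm of Katz and its application to the inverse Galois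
  problem*, J. Symbolic Comput. 30 (2000) 761–798: §3 (`U_i(τ)`, `U_{r+1}`), Prop. 3.2, Thm. 3.5,
  Cor. 3.6, Thm. 4.9 [DettweilerReiter2000].
* M. Dettweiler, S. Reiter, *Middle convolution of Fuchsian systems and the construction of rigid
  differential systems*, J. Algebra 318 (2007) 1–24, Def. 2.1, Def. 2.3, Thm. 2.4 [DettweilerReiter2007].
* Y. Haraoka, *Linear Differential Equations in the Complex Domain*, LNM 2271 (2020), §7.5.1
  (pp. 194–196), Thm. 7.24 [Haraoka2020].
-/

noncomputable section

namespace Literature.AlgebraicGeometry.Motives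

namespace MiddleConvolution

open Module

/-! ### `λ = 1`: `MC_1(V) ≅ V` via `φ(w) = Σ_i (A_i - 1) w_i` ([DettweilerReiter2000, Prop. 3.2]) -/

section One

variable {K : Type*} [CommRing K] {V : Type*} [AddCommGroup V] [Module K V]
variable {ι : Type*} [Fintype ι] [LinearOrder ι]
variable (ρ : Representation K (FreeGroup ι) V)

/-- `Σ_j (A_j - 1)(e_i ⊗ x)_j = (A_i - 1) x`. [folklore] -/
theorem sum_sub_single (i : ι) (x : V) :
    (∑ j, (ρ (FreeGroup.of j) ((Pi.single i x : ι → V) j) - (Pi.single i x : ι → V) j)) =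
      ρ (FreeGroup.of i) x - x := by
  rw [Finset.sum_eq_single i]
  · rw [Pi.single_eq_same]
  · intro j _ hj
    rw [Pi.single_eq_of_ne hj, map_zero, sub_zero]
  · intro hi
    exact absurd (Finset.mem_univ i) hi

/-- For `λ = 1`: `B_k w = w + e_k ⊗ φ(w)` with `φ(w) = Σ_i (A_i - 1) w_i` (every defect `D_k(w)`
equals `φ(w)`, [DettweilerReiter2000, Lemma 2.7 (a)]; tree `defect_one`, `convolutionEnd_sub_self`).
[cite: DettweilerReiter2000, Proposition 3.2] -/
theorem convolutionEnd_one_apply (k : ι) (w : ι → V) :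
    convolutionEnd (tuple ρ) 1 k w = w + Pi.single k (∑ i, (ρ (FreeGroup.of i) (w i) - w i)) := by
  rw [← defect_one, ← convolutionEnd_sub_self, add_sub_cancel]

/-- **`𝒦 + ℒ_V(1) = ker φ`**: for `λ = 1`, `ℒ = {(v_i) | Σ (A_i - 1) v_i = 0} ⊇ 𝒦`
([DettweilerReiter2000, Lemma 2.7 (a) and proof of Prop. 3.2]).
[cite: DettweilerReiter2000, Proposition 3.2] -/
theorem mem_kerSum_one_iff (w : ι → V) :
    w ∈ kerSum ρ 1 ↔ (∑ i, (ρ (FreeGroup.of i) (w i) - w i)) = 0 := by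
  rw [mem_kerSum_iff]
  simp only [Units.val_one, sub_self, zero_smul]
  constructor
  · intro h
    cases isEmpty_or_nonempty ι with
    | inl hι => exact Finset.sum_of_isEmpty _
    | inr hι =>
      obtain ⟨k⟩ := hι
      obtain ⟨_, _, hd⟩ := h k
      rwa [defect_one] at hd
  · intro h k
    exact ⟨0, map_zero _, by rw [defect_one, h]⟩

/-- **`MC_1(V) ≅ V`** [DettweilerReiter2000, Prop. 3.2]: "Let `λ = 1` and `U_{r+1} = V`
(`U_{r+1} = Σ_{i ≤ r} im(A_i - 1)`, loc. cit. §3).  Then the modules `MC_1(V)` and `V` are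
isomorphic" — the isomorphism `MC_1(V) = V^r/(𝒦 + ℒ) → V` being induced by
`φ(v_1, …, v_r) = Σ_i (A_i - 1) v_i` (`ker φ = ℒ ⊇ 𝒦`, `φ` onto, `φ ∘ B_k = A_k ∘ φ`).  Proved as
printed; valid over any commutative ring and any finite ordered index set.
[cite: DettweilerReiter2000, Proposition 3.2] -/
theorem exists_equiv_one (hU : (⨆ i, LinearMap.range (tuple ρ i - 1)) = ⊤) :
    ∃ e : (middleConvolution ρ 1).Equiv ρ,
      ∀ w : ι → V, e (Submodule.Quotient.mk w) = ∑ i, (ρ (FreeGroup.of i) (w i) - w i) := by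
  -- Dettweiler–Reiter's map `φ : V^r → V`
  let φ : (ι → V) →ₗ[K] V := ∑ i, (tuple ρ i - 1) ∘ₗ LinearMap.proj i
  have hφ : ∀ w, φ w = ∑ i, (ρ (FreeGroup.of i) (w i) - w i) := fun w => by
    simp [φ, LinearMap.sum_apply]
  -- `ker φ = 𝒦 + ℒ`
  have hker : ∀ w, w ∈ kerSum ρ 1 ↔ φ w = 0 := fun w => by rw [hφ, mem_kerSum_one_iff]
  -- `φ ∘ B_k = A_k ∘ φ` ("readily checked")
  have hB : ∀ (k : ι) (w : ι → V), φ (convolutionEnd (tuple ρ) 1 k w) = ρ (FreeGroup.of k) (φ w) := by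
    intro k w
    rw [convolutionEnd_one_apply, LinearMap.map_add, hφ (Pi.single k _), sum_sub_single, ← hφ,
      add_sub_cancel]
  -- the induced map `ψ : V^r/(𝒦 + ℒ) → V` and its equivariance
  let ψ : Space ρ 1 →ₗ[K] V := (kerSum ρ 1).liftQ φ fun w hw => (hker w).1 hw
  have hψ : ∀ w, ψ (Submodule.Quotient.mk w) = φ w := fun w => rfl
  have hequiv : ∀ (g : FreeGroup ι) (x : Space ρ 1), ψ (middleConvolution ρ 1 g x) = ρ g (ψ x) := by
    refine isIntertwining_of_generators _ _ _ fun k x => ?_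
    obtain ⟨w, rfl⟩ := Submodule.Quotient.mk_surjective _ x
    rw [middleConvolution_of_mk, Units.val_one, hψ, hψ]
    exact hB k w
  -- `ψ` is injective (`ker φ = 𝒦 + ℒ`) and onto (`U_{r+1} = V`)
  have hinj : Function.Injective ψ := by
    intro x y hxy
    obtain ⟨v, rfl⟩ := Submodule.Quotient.mk_surjective _ x
    obtain ⟨w, rfl⟩ := Submodule.Quotient.mk_surjective _ y
    rw [hψ, hψ] at hxy
    rw [Submodule.Quotient.eq, hker, map_sub, hxy, sub_self]
  have hrange : (⨆ i, LinearMap.range (tuple ρ i - 1)) ≤ LinearMap.range ψ := by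
    refine iSup_le fun i => ?_
    rintro _ ⟨x, rfl⟩
    refine ⟨Submodule.Quotient.mk (Pi.single i x), ?_⟩
    rw [hψ, hφ, sum_sub_single]
    rfl
  have hsurj : Function.Surjective ψ := by
    rw [← LinearMap.range_eq_top, eq_top_iff, ← hU]
    exact hrange
  exact ⟨(LinearMap.intertwiningMap_of_isIntertwiningMap _ _ ψ hequiv).ofBijective ⟨hinj, hsurj⟩,
    fun w => (hψ w).trans (hφ w)⟩

/-- [DettweilerReiter2000, Prop. 3.2]: `U_{r+1} = V ⟹ MC_1(V) ≅ V`.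
[cite: DettweilerReiter2000, Proposition 3.2] -/
theorem nonempty_equiv_one (hU : (⨆ i, LinearMap.range (tuple ρ i - 1)) = ⊤) :
    Nonempty ((middleConvolution ρ 1).Equiv ρ) :=
  let ⟨e, _⟩ := exists_equiv_one ρ hU
  ⟨e⟩

end One

/-! ### Inversion `MC_{λ⁻¹} ∘ MC_λ ≅ id` under `(*)`, `(**)` -/

section Inversion

universe v w

variable {K : Type v} [Field K] {V : Type w} [AddCommGroup V] [Module K V]

/-- Condition `(**)` at `τ = 1` contains `U_{r+1} = Σ_i im(A_i - 1) = V` (for `r ≥ 1`;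
[DettweilerReiter2000, §3]: "Note that in this case we also have `U_{r+1} = V`").
[cite: DettweilerReiter2000, Proposition 3.2] -/
theorem iSup_range_sub_one_eq_top_of_condStarStar {ι : Type*} [Nonempty ι]
    (ρ : Representation K (FreeGroup ι) V) (hSS : CondStarStar ρ) :
    (⨆ i, LinearMap.range (tuple ρ i - 1)) = ⊤ := by
  obtain ⟨i⟩ := ‹Nonempty ι›
  have h := hSS i 1
  rw [Units.val_one, one_smul] at h
  rw [eq_top_iff, ← h]
  exact sup_le (iSup₂_le fun j _ => le_iSup (fun j => LinearMap.range (tuple ρ j - 1)) j)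
    (le_iSup (fun j => LinearMap.range (tuple ρ j - 1)) i)

/-- **Inversion of the middle convolution**: for a finite-dimensional module `V` over the free
group `F_r`, `r ≥ 1`, satisfying `(*)` and `(**)`, and any `λ ∈ Kˣ`,
`MC_{λ⁻¹}(MC_λ(V)) ≅ V` as `F_r`-modules — multiplicativity [DettweilerReiter2000, Thm. 3.5]
(tree: `DettweilerReiter2007_mul_holds`) followed by `MC_1(V) ≅ V` [DettweilerReiter2000, Prop. 3.2]
(`exists_equiv_one`); the step `W := MC_{λ⁻¹}(M) ≤ V` of [DettweilerReiter2000, proof of Cor. 3.6] and the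
tuple form of Katz's `MC_χ̄(MC_χ(𝓕)) ≅ 𝓕`. [cite: DettweilerReiter2000, Theorem 3.5 and Proposition 3.2] -/
theorem middleConvolution_inv_equiv [FiniteDimensional K V] {r : ℕ} (hr : 0 < r)
    (ρ : Representation K (FreeGroup (Fin r)) V) (hS : CondStar ρ) (hSS : CondStarStar ρ) (l : Kˣ) :
    Nonempty ((middleConvolution (middleConvolution ρ l) l⁻¹).Equiv ρ) := by
  haveI : Nonempty (Fin r) := ⟨⟨0, hr⟩⟩
  obtain ⟨e⟩ := DettweilerReiter2007_mul_holds K V r ρ l l⁻¹ hS hSS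
  rw [mul_inv_cancel] at e
  obtain ⟨e₁⟩ := nonempty_equiv_one ρ (iSup_range_sub_one_eq_top_of_condStarStar ρ hSS)
  exact ⟨e.trans e₁⟩

/-- Symmetric form `MC_λ(MC_{λ⁻¹}(V)) ≅ V`. [cite: DettweilerReiter2000, Theorem 3.5 and Proposition 3.2] -/
theorem middleConvolution_equiv_inv [FiniteDimensional K V] {r : ℕ} (hr : 0 < r)
    (ρ : Representation K (FreeGroup (Fin r)) V) (hS : CondStar ρ) (hSS : CondStarStar ρ) (l : Kˣ) :
    Nonempty ((middleConvolution (middleConvolution ρ l⁻¹) l).Equiv ρ) := by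
  have h := middleConvolution_inv_equiv hr ρ hS hSS l⁻¹
  rwa [inv_inv] at h

/-- Inversion for **irreducible** modules of rank `≥ 2` (which satisfy `(*)`, `(**)`:
[DettweilerReiter2000, Remark 3.1], tree `RigidTuple.condStar_of_isIrreducible`,
`condStarStar_of_isIrreducible`). [cite: DettweilerReiter2000, Theorem 3.5 and Remark 3.1] -/
theorem middleConvolution_inv_equiv_of_isIrreducible [FiniteDimensional K V] {r : ℕ} (hr : 0 < r)
    (ρ : Representation K (FreeGroup (Fin r)) V) (hirr : ρ.IsIrreducible) (h2 : 2 ≤ finrank K V)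
    (l : Kˣ) : Nonempty ((middleConvolution (middleConvolution ρ l) l⁻¹).Equiv ρ) :=
  middleConvolution_inv_equiv hr ρ (RigidTuple.condStar_of_isIrreducible ρ hirr h2)
    (RigidTuple.condStarStar_of_isIrreducible ρ hirr h2) l

end Inversion

end MiddleConvolution

/-! ### Katz's existence algorithm: `DettweilerReiter2000_thm_4_9` holds -/

/-- **[DettweilerReiter2000, Thm. 4.9] holds** (Katz's existence algorithm for irreducible linearly
rigid tuples with `T_∞ = 1` over an algebraically closed field; = [Haraoka2020, Thm. 7.24]): the
tree's reduction `DettweilerReiter2000_thm_4_9_of_lemma_4_7` applied to the tree's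
`DettweilerReiter2000_lemma_4_7_holds`.  Discharges the named fact `DettweilerReiter2000_thm_4_9` of
`RigidTuples.lean`. [cite: DettweilerReiter2000, Theorem 4.9] -/
theorem DettweilerReiter2000_thm_4_9_holds : DettweilerReiter2000_thm_4_9 :=
  DettweilerReiter2000_thm_4_9_of_lemma_4_7 DettweilerReiter2000_lemma_4_7_holds

end Literature.AlgebraicGeometry.Motives

end
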